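import Mathlib
import Summits.ValiantsHypothesis.ValiantsHypothesis.Theorems.GeneratorObstructionsPowGenDegreeQPGadgetTableauFibres

/-!
# Route GeneratorObstructions — crux K2 `PowGenDegreeQP` (stmt-ValiantsHypothesis-11655), line
# `trace-side-regimes`: the letters received by the boxes under a fibrewise rearrangement

Step (R2, second part) of the last certificate theorem (`gadgetTab_fiberSum_eq_pow`, skeleton on the
item).  For a fibrewise tuple `ρ : Π n, Π j, Perm {r // rowBlock n r = j}` of the gadget tableau and
the assembled column permutations `π = fiberPermPi rowBlock ρ`:

* `labelOf j q ℓ` — the label `3(2^j - 1 + q) + ℓ` of block `j`, copy `q`, D*-label `ℓ`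
  (`labBlock_labelOf`, `labCopy_labelOf`, `labLab_labelOf`), and every label is of this form
  (`labelOf_surj`);
* `fiberPerm_apply_of_eq` — `π n r = ρ n j ⟨r, _⟩` once `rowBlock n r = j` (the `subst` lemma);
* `word_triple` / `word_pair` — **the letter received by the `s`-th box of `labelOf j q ℓ` is
  `x (letterRow c j κ')` where `κ'` is the image of the box's kind under the TRANSPORTED permutation**
  `(fibreEquivTriple …).permCongr (ρ n j)` (triple boxes, `s < 3k`, column `n = 3kq + s`, kind
  `(tripleLabNat k s)⁻¹ ℓ`) resp. `(fibreEquivPair …).permCongr (ρ n j)` (pair boxes, `s = 3k + t`,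
  column `n = 3k·2^j + 3kq + pairIdx ℓ t`, kind `pairKind`).

With these, validity of the labels of copy `(j,q)` is a statement about `3k` permutations of `Fin 3`
and `3k` of `Fin 2` — the `D*` configuration of `…BlockCountGen` — which is what remains to count.

Honest framing: combinatorics of one explicit tableau; no stub, crux or summit is settled here;
`VP ≠ VNP` untouched. [folklore]
-/

namespace Summit.ValiantsHypothesis.ValiantsHypothesis.Theorems.GeneratorObstructions.PowGenDegreeQP

open Literature.Computability.AlgebraicComplexity Literature.Computability.AlgebraicComplexity.TableauEval

-- `Summit.ValiantsHypothesis.ValiantsHypothesis.…` is the tree's mandated single-conjunct layout.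
set_option linter.dupNamespace false

noncomputable section

/-! ## §1 Labels by (block, copy, D*-label) -/

/-- The label of block `j`, copy `q < 2^j`, D*-label `ℓ`. [folklore] -/
def labelOf (j q : ℕ) (ℓ : Fin 3) : ℕ := 3 * (2 ^ j - 1 + q) + ℓ.val

/-- `labelOf` lands below `3(2^c - 1)`. [folklore] -/
theorem labelOf_lt {c j q : ℕ} (hj : j < c) (hq : q < 2 ^ j) (ℓ : Fin 3) :
    labelOf j q ℓ < 3 * (2 ^ c - 1) := by
  unfold labelOf
  have h1 : 2 ^ (j + 1) ≤ 2 ^ c := Nat.pow_le_pow_right (by norm_num) hj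
  have h2 : 1 ≤ 2 ^ j := Nat.one_le_two_pow
  have := ℓ.isLt
  rw [pow_succ] at h1
  omega

/-- Block of `labelOf`. [folklore] -/
theorem labBlock_labelOf {j q : ℕ} (hq : q < 2 ^ j) (ℓ : Fin 3) : labBlock (labelOf j q ℓ) = j := by
  rw [labBlock_eq_iff]
  unfold labelOf
  have := ℓ.isLt
  have h2 : 1 ≤ 2 ^ j := Nat.one_le_two_pow
  rw [pow_succ]
  omega

/-- D*-label of `labelOf`. [folklore] -/
theorem labLab_labelOf (j q : ℕ) (ℓ : Fin 3) : labLab (labelOf j q ℓ) = ℓ := by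
  apply Fin.ext
  simp only [labLab, labelOf]
  have := ℓ.isLt
  omega

/-- Copy of `labelOf`. [folklore] -/
theorem labCopy_labelOf {j q : ℕ} (hq : q < 2 ^ j) (ℓ : Fin 3) : labCopy (labelOf j q ℓ) = q := by
  unfold labCopy
  rw [labBlock_labelOf hq]
  unfold labelOf
  have := ℓ.isLt
  have h2 : 1 ≤ 2 ^ j := Nat.one_le_two_pow
  omega

/-- Every label is a `labelOf`. [folklore] -/
theorem labelOf_surj {c : ℕ} (u : Fin (3 * (2 ^ c - 1))) :
    labelOf (labBlock u) (labCopy u) (labLab u) = u.val := by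
  obtain ⟨-, -, h⟩ := labBlock_lt u
  have h2 : 1 ≤ 2 ^ labBlock u.val := Nat.one_le_two_pow
  unfold labelOf
  have hl : (labLab u).val = u.val % 3 := rfl
  omega

/-! ## §2 The received letters -/

/-- Equality in the box type `Σ m : Fin C, Fin (h m)` from equality of the two values. [folklore] -/
theorem sigma_fin_ext {C : ℕ} {h : Fin C → ℕ} {a b : (m : Fin C) × Fin (h m)} (h1 : a.1 = b.1)
    (h2 : a.2.val = b.2.val) : a = b := by
  obtain ⟨a1, a2⟩ := a
  obtain ⟨b1, b2⟩ := b
  simp only at h1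
  subst h1
  simp only [Sigma.mk.injEq, heq_eq_eq, true_and]
  exact Fin.ext h2

variable {σ : Type*}

/-- The `subst` lemma: on a row of block `j`, the assembled permutation is `ρ n j`. [folklore] -/
theorem fiberPerm_apply_of_eq {α K : Type*} (f : α → K) (ρ : (k : K) → Equiv.Perm {a : α // f a = k})
    {a : α} {k : K} (h : f a = k) : (fiberPerm f ρ a : α) = (ρ k ⟨a, h⟩).val := by
  subst h; rfl

/-- A transported fibre permutation, read back on rows: for `r` in the block-`j` fibre of a column
`n < 3k·2^j`, `ρ n j` sends `r` to the row of kind `((fibreEquivTriple …).permCongr (ρ n j)) (kind r)`.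
[folklore] -/
theorem fibre_perm_val_triple (k c : ℕ) (hk : 1 ≤ k) (hc : 1 ≤ c) (x : ℕ → σ)
    (n : Fin (gadgetTab k c hk hc x).C) (j : Fin c) (hn : n.val < 3 * k * 2 ^ j.val)
    (ρ : Equiv.Perm {r : Fin ((gadgetTab k c hk hc x).h n) // rowBlock k c hk hc x n r = j})
    (κ : Fin 3) :
    ((ρ ((fibreEquivTriple k c hk hc x n j hn).symm κ)).1 : ℕ) =
      letterRow c j (((fibreEquivTriple k c hk hc x n j hn).permCongr ρ) κ) := by
  rw [Equiv.permCongr_apply, fibreEquivTriple_apply]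
  exact fibre_val_eq k c hk hc x _

/-- Same for pair columns. [folklore] -/
theorem fibre_perm_val_pair (k c : ℕ) (hk : 1 ≤ k) (hc : 1 ≤ c) (x : ℕ → σ)
    (n : Fin (gadgetTab k c hk hc x).C) (j : Fin c) (hn1 : 3 * k * 2 ^ j.val ≤ n.val)
    (hn2 : n.val < 3 * k * 2 ^ (j.val + 1))
    (ρ : Equiv.Perm {r : Fin ((gadgetTab k c hk hc x).h n) // rowBlock k c hk hc x n r = j})
    (κ : Fin 2) :
    ((ρ ((fibreEquivPair k c hk hc x n j hn1 hn2).symm κ)).1 : ℕ) =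
      letterRow c j (Fin.castSucc (((fibreEquivPair k c hk hc x n j hn1 hn2).permCongr ρ) κ)) := by
  rw [Equiv.permCongr_apply]
  have h := fibre_val_eq k c hk hc x (ρ ((fibreEquivPair k c hk hc x n j hn1 hn2).symm κ))
  rw [h]
  congr 1

/-- **Letters received by triple boxes.**  For `u = labelOf j q ℓ` and `s < 3k`, the `s`-th box sits
in column `n = 3kq + s` on the row of kind `κ = (tripleLabNat k s)⁻¹ ℓ`, and under
`π = fiberPermPi rowBlock ρ` it receives the letter of the row of kind
`((fibreEquivTriple …).permCongr (ρ n j)) κ`. [folklore] -/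
theorem word_triple (k c : ℕ) (hk : 1 ≤ k) (hc : 1 ≤ c) (x : ℕ → σ)
    (ρ : (n : Fin (gadgetTab k c hk hc x).C) → (j : Fin c) →
      Equiv.Perm {r : Fin ((gadgetTab k c hk hc x).h n) // rowBlock k c hk hc x n r = j})
    (j : Fin c) {q : ℕ} (hq : q < 2 ^ j.val) (ℓ : Fin 3) {s : ℕ} (hs : s < 3 * k)
    (hn : 3 * k * q + s < (gadgetTab k c hk hc x).C) (hn' : 3 * k * q + s < 3 * k * 2 ^ j.val) :
    (gadgetTab k c hk hc x).word (fiberPermPi (rowBlock k c hk hc x) ρ)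
        ⟨labelOf j q ℓ, labelOf_lt j.isLt hq ℓ⟩ ⟨s, by change s < 5 * k; omega⟩ =
      x (letterRow c j (((fibreEquivTriple k c hk hc x ⟨3 * k * q + s, hn⟩ j hn').permCongr
        (ρ ⟨3 * k * q + s, hn⟩ j)) ((tripleLabNat k s)⁻¹ ℓ))) := by
  -- the box
  have hbox : (gadgetTab k c hk hc x).box ⟨labelOf j q ℓ, labelOf_lt j.isLt hq ℓ⟩
      ⟨s, by change s < 5 * k; omega⟩ =
      ⟨⟨3 * k * q + s, hn⟩, ⟨letterRow c j ((tripleLabNat k s)⁻¹ ℓ),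
        letterRow_lt_colHeight_of_lt hk j.isLt hn' _⟩⟩ := by
    have h1 : boxColRow k c (labelOf j q ℓ) s =
        (3 * k * q + s, letterRow c j ((tripleLabNat k s)⁻¹ ℓ)) := by
      unfold boxColRow
      rw [if_pos hs, labCopy_labelOf hq, labBlock_labelOf hq, labLab_labelOf]
    apply sigma_fin_ext
    · exact Fin.ext (congrArg Prod.fst h1)
    · exact congrArg Prod.snd h1
  rw [TabM.word, hbox]
  change x _ = x _
  congr 1
  -- the received row
  have hrb : rowBlock k c hk hc x ⟨3 * k * q + s, hn⟩
      ⟨letterRow c j ((tripleLabNat k s)⁻¹ ℓ), letterRow_lt_colHeight_of_lt hk j.isLt hn' _⟩ = j :=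
    Fin.ext (blockOfRow_letterRow j.isLt _)
  change ((fiberPermPi (rowBlock k c hk hc x) ρ ⟨3 * k * q + s, hn⟩ _) : Fin _).val = _
  rw [fiberPermPi, fiberPerm_apply_of_eq (rowBlock k c hk hc x ⟨3 * k * q + s, hn⟩) (ρ _) hrb]
  rw [← fibre_perm_val_triple k c hk hc x ⟨3 * k * q + s, hn⟩ j hn' (ρ _ j)]
  rfl

/-- **Letters received by pair boxes.**  For `u = labelOf j q ℓ` and `t < 2k`, the `(3k+t)`-th box sits
in column `n = 3k·2^j + 3kq + pairIdx k ℓ t` on the row of kind `pairKind k ℓ (pairIdx k ℓ t)` (as an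
element of `Fin 2`), and under `π = fiberPermPi rowBlock ρ` it receives the letter of the row of kind
`((fibreEquivPair …).permCongr (ρ n j)) κ`. [folklore] -/
theorem word_pair (k c : ℕ) (hk : 1 ≤ k) (hc : 1 ≤ c) (x : ℕ → σ)
    (ρ : (n : Fin (gadgetTab k c hk hc x).C) → (j : Fin c) →
      Equiv.Perm {r : Fin ((gadgetTab k c hk hc x).h n) // rowBlock k c hk hc x n r = j})
    (j : Fin c) {q : ℕ} (hq : q < 2 ^ j.val) (ℓ : Fin 3) {t : ℕ} (ht : t < 2 * k)
    (hn : 3 * k * 2 ^ j.val + 3 * k * q + pairIdx k ℓ t < (gadgetTab k c hk hc x).C)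
    (hn1 : 3 * k * 2 ^ j.val ≤ 3 * k * 2 ^ j.val + 3 * k * q + pairIdx k ℓ t)
    (hn2 : 3 * k * 2 ^ j.val + 3 * k * q + pairIdx k ℓ t < 3 * k * 2 ^ (j.val + 1)) :
    (gadgetTab k c hk hc x).word (fiberPermPi (rowBlock k c hk hc x) ρ)
        ⟨labelOf j q ℓ, labelOf_lt j.isLt hq ℓ⟩ ⟨3 * k + t, by change 3 * k + t < 5 * k; omega⟩ =
      x (letterRow c j (Fin.castSucc
        (((fibreEquivPair k c hk hc x ⟨_, hn⟩ j hn1 hn2).permCongr (ρ ⟨_, hn⟩ j))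
          ⟨(pairKind k ℓ (pairIdx k ℓ t)).val,
            by have := pairKind_ne_two k ℓ (pairIdx k ℓ t)
               have h3 := (pairKind k ℓ (pairIdx k ℓ t)).isLt
               omega⟩))) := by
  have hκ2 : pairKind k ℓ (pairIdx k ℓ t) ≠ 2 := pairKind_ne_two k ℓ (pairIdx k ℓ t)
  have hlt : letterRow c j (pairKind k ℓ (pairIdx k ℓ t)) <
      colHeight k c (3 * k * 2 ^ j.val + 3 * k * q + pairIdx k ℓ t) :=
    letterRow_lt_colHeight_pair hk j.isLt hn1 hn2 hκ2
  -- the box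
  have hbox : (gadgetTab k c hk hc x).box ⟨labelOf j q ℓ, labelOf_lt j.isLt hq ℓ⟩
      ⟨3 * k + t, by change 3 * k + t < 5 * k; omega⟩ =
      ⟨⟨3 * k * 2 ^ j.val + 3 * k * q + pairIdx k ℓ t, hn⟩,
        ⟨letterRow c j (pairKind k ℓ (pairIdx k ℓ t)), hlt⟩⟩ := by
    have h1 : boxColRow k c (labelOf j q ℓ) (3 * k + t) =
        (3 * k * 2 ^ j.val + 3 * k * q + pairIdx k ℓ t,
          letterRow c j (pairKind k ℓ (pairIdx k ℓ t))) := by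
      unfold boxColRow
      rw [if_neg (by omega), labCopy_labelOf hq, labBlock_labelOf hq, labLab_labelOf,
        show 3 * k + t - 3 * k = t by omega]
    apply sigma_fin_ext
    · exact Fin.ext (congrArg Prod.fst h1)
    · exact congrArg Prod.snd h1
  rw [TabM.word, hbox]
  change x _ = x _
  congr 1
  have hrb : rowBlock k c hk hc x ⟨3 * k * 2 ^ j.val + 3 * k * q + pairIdx k ℓ t, hn⟩
      ⟨letterRow c j (pairKind k ℓ (pairIdx k ℓ t)), hlt⟩ = j :=
    Fin.ext (blockOfRow_letterRow j.isLt _)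
  change ((fiberPermPi (rowBlock k c hk hc x) ρ ⟨_, hn⟩ _) : Fin _).val = _
  rw [fiberPermPi, fiberPerm_apply_of_eq (rowBlock k c hk hc x ⟨_, hn⟩) (ρ _) hrb]
  rw [← fibre_perm_val_pair k c hk hc x ⟨_, hn⟩ j hn1 hn2 (ρ _ j)]
  rfl


end

end Summit.ValiantsHypothesis.ValiantsHypothesis.Theorems.GeneratorObstructions.PowGenDegreeQP
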